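import Mathlib
import Literature.Analysis.FluidPDE.ClassicalSolution

/-!
# Route SelfMixingDichotomy — crux `CoherentScaleExclusion` (S2, item 1423): kinematic witness,
# window bounds from spatially compact support

Generic tool for the kinematic witness against stub B of
`Cruxes/CoherentScaleExclusion/Lines/birth.lean`: a field `u : ℝ → ℝ³ → ℝ³` that is jointly
`C^∞` on an open space–time set `U ⊇ [a, b] × ℝ³` and vanishes on `{p ∈ U | R ≤ ‖p.2‖}` is
`IsSmoothSpaceTimeOn (Icc a b) u`, and all its iterated derivatives within `[a, b] × ℝ³` are
uniformly bounded: on the compact `[a, b] × closedBall 0 (R + 1)` by continuity of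
`iteratedFDeriv ℝ n (uncurry u)` on the open `U`, and outside it the derivatives vanish because
`uncurry u` is locally zero on the open set `U ∩ {R < ‖p.2‖}`.
-/

noncomputable section

set_option linter.dupNamespace false

namespace Summit.NavierStokesRegularity.NavierStokesRegularity.Theorems

open Set Function Filter Topology Metric
open Literature.Analysis.FluidPDE

/-- **Window bounds from spatially compact support.** If `uncurry u` is `C^∞` on an open
space–time set `U ⊇ Icc a b ×ˢ univ` (`a < b`) and vanishes at the points `p ∈ U` with
`R ≤ ‖p.2‖`, then `u` is jointly smooth on the window `[a, b]` and every iterated derivative of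
`uncurry u` within `Icc a b ×ˢ univ` is bounded uniformly on the window (continuity on the
compact `Icc a b ×ˢ closedBall 0 (R + 1)`; zero germ, hence zero derivatives, farther out).
[folklore] -/
theorem kinWitness_windowBounds_of_spatialSupport : ∀ (u : ℝ → EuclideanSpace ℝ (Fin 3) → EuclideanSpace ℝ (Fin 3)) (U : Set (ℝ × EuclideanSpace ℝ (Fin 3))) (a b R : ℝ), a < b → IsOpen U → Set.Icc a b ×ˢ Set.univ ⊆ U → ContDiffOn ℝ (⊤ : ℕ∞) (Function.uncurry u) U → (∀ p ∈ U, R ≤ ‖p.2‖ → Function.uncurry u p = 0) → Literature.Analysis.FluidPDE.IsSmoothSpaceTimeOn (Set.Icc a b) u ∧ ∀ n : ℕ, ∃ C : ℝ, ∀ t ∈ Set.Icc a b, ∀ x : EuclideanSpace ℝ (Fin 3), ‖iteratedFDerivWithin ℝ n (Function.uncurry u) (Set.Icc a b ×ˢ Set.univ) (t, x)‖ ≤ C := by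
  intro u U a b R hab hUo hsub hcd hvan
  refine ⟨hcd.mono hsub, fun n => ?_⟩
  -- the window slab is a set of unique differentiability inside the open `U`
  have hsU : UniqueDiffOn ℝ (Set.Icc a b ×ˢ (Set.univ : Set (EuclideanSpace ℝ (Fin 3)))) :=
    (uniqueDiffOn_Icc hab).prod uniqueDiffOn_univ
  -- within-slab derivatives agree with the global ones (the function is `C^∞` near each point)
  have heq : ∀ p ∈ Set.Icc a b ×ˢ (Set.univ : Set (EuclideanSpace ℝ (Fin 3))),
      iteratedFDerivWithin ℝ n (Function.uncurry u) (Set.Icc a b ×ˢ Set.univ) p =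
        iteratedFDeriv ℝ n (Function.uncurry u) p := fun p hp =>
    iteratedFDerivWithin_eq_iteratedFDeriv hsU
      ((hcd.contDiffAt (hUo.mem_nhds (hsub hp))).of_le (mod_cast le_top)) hp
  -- the global `n`-th derivative is continuous on the open `U`
  have hcont : ContinuousOn (iteratedFDeriv ℝ n (Function.uncurry u)) U :=
    ContinuousOn.continuousOn_iteratedFDeriv hcd hUo (mod_cast le_top)
  -- bound on the compact piece `Icc a b ×ˢ closedBall 0 (R + 1)`
  have hKc : IsCompact (Set.Icc a b ×ˢ closedBall (0 : EuclideanSpace ℝ (Fin 3)) (R + 1)) :=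
    isCompact_Icc.prod (isCompact_closedBall 0 (R + 1))
  have hKs : Set.Icc a b ×ˢ closedBall (0 : EuclideanSpace ℝ (Fin 3)) (R + 1) ⊆
      Set.Icc a b ×ˢ (Set.univ : Set (EuclideanSpace ℝ (Fin 3))) :=
    Set.prod_mono Subset.rfl (Set.subset_univ _)
  obtain ⟨C₁, hC₁⟩ := hKc.exists_bound_of_continuousOn (hcont.mono (hKs.trans hsub))
  refine ⟨max C₁ 0, fun t ht x => ?_⟩
  have hp : ((t, x) : ℝ × EuclideanSpace ℝ (Fin 3)) ∈ Set.Icc a b ×ˢ (Set.univ : Set _) :=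
    Set.mk_mem_prod ht (Set.mem_univ x)
  rw [heq _ hp]
  by_cases hx : ‖x‖ ≤ R + 1
  · exact (hC₁ _ (Set.mk_mem_prod ht (mem_closedBall_zero_iff.2 hx))).trans (le_max_left _ _)
  · -- far out: `uncurry u` vanishes on the open neighbourhood `U ∩ {R < ‖p.2‖}` of `(t, x)`
    push Not at hx
    have hV : IsOpen (U ∩ {p : ℝ × EuclideanSpace ℝ (Fin 3) | R < ‖p.2‖}) :=
      hUo.inter (isOpen_lt continuous_const (continuous_norm.comp continuous_snd))
    have hmem : ((t, x) : ℝ × EuclideanSpace ℝ (Fin 3)) ∈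
        U ∩ {p : ℝ × EuclideanSpace ℝ (Fin 3) | R < ‖p.2‖} :=
      ⟨hsub hp, by simp only [Set.mem_setOf_eq]; linarith⟩
    have hloc : Function.uncurry u =ᶠ[𝓝 ((t, x) : ℝ × EuclideanSpace ℝ (Fin 3))]
        fun _ => 0 := by
      filter_upwards [hV.mem_nhds hmem] with q hq
      have hq2 : R < ‖q.2‖ := hq.2
      exact hvan q hq.1 hq2.le
    rw [(hloc.iteratedFDeriv ℝ n).eq_of_nhds, iteratedFDeriv_fun_zero, Pi.zero_apply, norm_zero]
    exact le_max_right _ _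

end Summit.NavierStokesRegularity.NavierStokesRegularity.Theorems
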